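import Summits.Ventures.AbcSig.Rows.Bridge
import Summits.Ventures.AbcSig.Rows.C2aL251A0
import Summits.Ventures.AbcSig.Rows.C2aL251A0AB

/-!
# Venture AbcSig — CELL `C2aL251A0`: the census statement `Rows.C2aCellRed 251 (fun a => a = 0) {11}` from the two row theorems

HONEST FRAMING. COMPUTATION cell `pub-abcsig`; CONDITIONAL theorem; no claim on ABC or any summit. Hypotheses exactly as
in `Rows/C2aL251A0.lean` and `Rows/C2aL251A0AB.lean`: `BS04Package` (CITED), `DataComplete …` (COMPUTED level files), and the
rows' per-orbit exclusions for `famB` as universally quantified hypotheses (CITED: the census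
row's certificates). Conclusion = p1's census predicate (`Rows/Statements.lean`), all four coprime coefficient
distributions `A·B = 2^a·251^m`, reduced exponents `a < n`, `m < n` (RULING H1). GENERATED by p-lean gen/make_rows.py
(after plean/make_cell_bridges.py).
-/

namespace Summit.Ventures.AbcSig

/-- Cell `C2aL251A0`: `Rows.C2aCellRed 251 (fun a => a = 0) {11}` under the rows' hypotheses. -/
theorem cell_C2aL251A0 (M : NewformModel) (hP : M.BS04Package)
    (hD502 : M.DataComplete 502 level502Orbits)
    (hD8032 : M.DataComplete 8032 level8032Orbits) :
    Rows.C2aCellRed 251 (fun a => a = 0) {11} :=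
  C2aCellRed_of_rows 251 (by norm_num) (by norm_num) _ _
    (fun n hn h11 hnℓ hR a m (ha : a = 0) han hm hmn x y z h1 h2 => by
      subst ha
      exact
 row_C2aL251A0 M hP hD502 hD8032 n hn h11 hnℓ (by simpa using hR) m hm hmn x y z h1 h2)
    (fun n hn h11 hnℓ hR a m (ha : a = 0) han hm hmn x y z h1 h2 => by
      subst ha
      exact
 row_C2aL251A0AB M hP hD502 hD8032 n hn h11 hnℓ (by simpa using hR) m hm hmn x y z h1 h2)

end Summit.Ventures.AbcSig
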